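import Summits.FinalStateConjecture.FinalStateConjecture.Cruxes.KillingSpinorEndgame.Lines.birth

/-!
# Restatement proposal, corrected (continuation lead c1, 2026-08-17) — crux `KillingSpinorEndgame`
# (stmt-FinalStateConjecture-17645), companion of `Lines/registered_dead.md`

`Lines/birth_restated.lean` (first lead) repairs clause (i) of the crux by (1) intrinsic lateness —
the leaf avoids `J⁻(K)` for every compact `K` — and (2) orthochronous motions, but it PINS the lab
label of the leaf to `0` while the configuration `(Λⱼ, cⱼ)` stays fixed outside the `∀ ε ∀ K`. For
`N ≥ 2` holes with non-parallel asymptotic velocities that is unsatisfiable at late `K` (dossier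
`Lines/registered_dead.md` §5.1: the near-disc centres sit at FIXED chart separation `d` on every leaf,
the far zone pins the chart frame along the segment between them to within rapidity `O(ε d)` of hole
1's configured frame, in which hole 2 is at spatial distance `≍ |Δv| t → ∞` at equal times — so no
`ε`-good leaf through both late near zones exists once `t ≫ d / |Δv|`); the restated CAPTURE would
then be false on every datum forming two receding holes and the restated ENDGAME vacuous there.

The minimal correct repair keeps the filed text's `∃ τ` (the label stays free, so receding holes sit at
chart separation growing with `τ`, as in the filed clause) and adds the two new conjuncts:
`RecursLateFree` below = the nine slab clauses of the filed clause (i) verbatim at label `τ`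
(`Birth.Recurs` body) + `Disjoint (Φ '' {x⁰ = τ}) (J⁻ K)` for every compact `K` + orthochronous
motions. `KillingSpinorEndgameLateFree` is the crux over it (hypothesis (ii) and conclusion verbatim);
`Sig.stub_dynamicsFree` / `Sig.stub_packagingFree` and `killingSpinorEndgameLateFree_of` are the
two-stub re-line (composition proved, no `sorry`). Scratch for the PLANNER — statement items are the
planner's; nothing here is proposed to the tree.
-/

open Literature.Geometry.Lorentzian
open scoped Manifold ContDiff Topology ENNReal
open Filter Set TopologicalSpace

set_option linter.dupNamespace false

namespace Summit.FinalStateConjecture.FinalStateConjecture.Cruxes.KillingSpinorEndgame.ProposedC1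

open Summit.FinalStateConjecture.FinalStateConjecture.Theses.KerrnessPropagates
open Summit.FinalStateConjecture.FinalStateConjecture.Cruxes.KillingSpinorEndgame.Birth

noncomputable section

variable {X : Type} [TopologicalSpace X] [ChartedSpace E3 X] [IsManifold (𝓡 3) ∞ X]
  [ConnectedSpace X] {D : InitialDataSet (𝓡 3) X}

/-- **Late recurrence, label free** (proposed clause (i), corrected): every motion is orthochronous,
and for every `ε > 0` and EVERY COMPACT `K ⊆ M` there are a lab label `τ`, radii `R`, and an
`ε`-good slab chart `Φ` at label `τ` (the filed crux's nine slab clauses verbatim) whose leaf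
`Φ '' {x⁰ = τ}` is DISJOINT FROM `J⁻(K)`. Lateness is intrinsic (the `J⁻(K)` clause is about the
image, so the comoving relabelling of `slabClauses_translate` cannot manufacture it), and the free
label lets receding holes sit at chart separation growing with `τ`. [cite: DafermosLuk2017, Conjecture 1] -/
def RecursLateFree (𝒟 : VacuumCauchyDevelopment D) (k N : ℕ) (M a r₀ : Fin N → ℝ)
    (mo : Fin N → ↥lorentzGroup × E4) : Prop :=
  (∀ i, Summit.FinalStateConjecture.IsOrthochronous (mo i).1) ∧
  ∀ ε : ℝ, 0 < ε → ∀ K : Set 𝒟.carrier, IsCompact K →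
    ∃ (τ : ℝ) (R : Fin N → ℝ) (U : Opens E4) (Φ : U → 𝒟.carrier), (∀ i, r₀ i + 1 ≤ R i) ∧
      ContMDiff 𝓘(ℝ, E4) (𝓡 4) ∞ Φ ∧ Topology.IsOpenEmbedding Φ ∧
      {x : E4 | x 0 = τ ∧ ∀ j, r₀ j < Kerr.radius (a j) (poincareInv (mo j).1 (mo j).2 x)} ⊆
        (U : Set E4) ∧
      range Φ ⊆ 𝒟.metric.causalFuture 𝒟.timeOrientation (range 𝒟.embed) ∧
      Disjoint (Φ '' {x : ↥U | (x : E4) 0 = τ}) (𝒟.metric.causalPast 𝒟.timeOrientation K) ∧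
      𝒟.metric.IsAchronal 𝒟.timeOrientation (Φ '' {x : ↥U | (x : E4) 0 = τ}) ∧
      (∀ i, supCkENorm {x : E4 | x 0 = τ ∧
          (∀ j, r₀ j < Kerr.radius (a j) (poincareInv (mo j).1 (mo j).2 x)) ∧
          Kerr.radius (a i) (poincareInv (mo i).1 (mo i).2 x) ≤ R i} k
        (𝒟.toSpacetime.deviationExtend ⟨U, boostedKerrBilin (mo i).1 (mo i).2 (M i) (a i),
          fun x ↦ x 0, fun x ↦ Kerr.radius (a i) (poincareInv (mo i).1 (mo i).2 x)⟩ Φ) ≤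
        ENNReal.ofReal ε) ∧
      supCkENorm {x : E4 | x 0 = τ ∧
          (∀ j, r₀ j < Kerr.radius (a j) (poincareInv (mo j).1 (mo j).2 x)) ∧
          ∀ j, R j - 1 ≤ Kerr.radius (a j) (poincareInv (mo j).1 (mo j).2 x)} k
        (𝒟.toSpacetime.deviationExtend (Minkowski.backgroundOn U) Φ) ≤ ENNReal.ofReal ε ∧
      (∀ x : ↥U, x.1 0 = τ →
        (∀ j, R j - 1 ≤ Kerr.radius (a j) (poincareInv (mo j).1 (mo j).2 x.1)) →
        𝒟.timeOrientation.IsFutureDirected (mfderiv 𝓘(ℝ, E4) (𝓡 4) Φ x (E4.basisVector 0)))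

/-- **Late recurrence implies the filed recurrence at each fixed label-free accuracy, minus lateness**:
dropping the `J⁻(K)` clause (take `K = ∅`) and the orthochronous conjunct leaves, for every `ε`, ONE
`ε`-good slab — which by the first lead's `recurrence_one_iff` (p152635) is all the filed clause (i)
says for `N ≤ 1`. Recorded to make the comparison with `Birth.Recurs` explicit: for each `ε` the body
is `Recurs`'s body at some label `τ`. [folklore] -/
theorem RecursLateFree.exists_slab {𝒟 : VacuumCauchyDevelopment D} {k N : ℕ} {M a r₀ : Fin N → ℝ}
    {mo : Fin N → ↥lorentzGroup × E4} (h : RecursLateFree 𝒟 k N M a r₀ mo) (ε : ℝ) (hε : 0 < ε) :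
    ∃ (τ : ℝ) (R : Fin N → ℝ) (U : Opens E4) (Φ : U → 𝒟.carrier), (∀ i, r₀ i + 1 ≤ R i) ∧
      ContMDiff 𝓘(ℝ, E4) (𝓡 4) ∞ Φ ∧ Topology.IsOpenEmbedding Φ ∧
      {x : E4 | x 0 = τ ∧ ∀ j, r₀ j < Kerr.radius (a j) (poincareInv (mo j).1 (mo j).2 x)} ⊆
        (U : Set E4) ∧
      range Φ ⊆ 𝒟.metric.causalFuture 𝒟.timeOrientation (range 𝒟.embed) ∧
      𝒟.metric.IsAchronal 𝒟.timeOrientation (Φ '' {x : ↥U | (x : E4) 0 = τ}) ∧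
      (∀ i, supCkENorm {x : E4 | x 0 = τ ∧
          (∀ j, r₀ j < Kerr.radius (a j) (poincareInv (mo j).1 (mo j).2 x)) ∧
          Kerr.radius (a i) (poincareInv (mo i).1 (mo i).2 x) ≤ R i} k
        (𝒟.toSpacetime.deviationExtend ⟨U, boostedKerrBilin (mo i).1 (mo i).2 (M i) (a i),
          fun x ↦ x 0, fun x ↦ Kerr.radius (a i) (poincareInv (mo i).1 (mo i).2 x)⟩ Φ) ≤
        ENNReal.ofReal ε) ∧
      supCkENorm {x : E4 | x 0 = τ ∧
          (∀ j, r₀ j < Kerr.radius (a j) (poincareInv (mo j).1 (mo j).2 x)) ∧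
          ∀ j, R j - 1 ≤ Kerr.radius (a j) (poincareInv (mo j).1 (mo j).2 x)} k
        (𝒟.toSpacetime.deviationExtend (Minkowski.backgroundOn U) Φ) ≤ ENNReal.ofReal ε ∧
      (∀ x : ↥U, x.1 0 = τ →
        (∀ j, R j - 1 ≤ Kerr.radius (a j) (poincareInv (mo j).1 (mo j).2 x.1)) →
        𝒟.timeOrientation.IsFutureDirected (mfderiv 𝓘(ℝ, E4) (𝓡 4) Φ x (E4.basisVector 0))) := by
  obtain ⟨τ, R, U, Φ, hR, hsm, hemb, hsub, hrange, -, hachr, hnear, hfar, hor⟩ :=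
    h.2 ε hε ∅ isCompact_empty
  exact ⟨τ, R, U, Φ, hR, hsm, hemb, hsub, hrange, hachr, hnear, hfar, hor⟩

/-- **The crux restated, corrected** (proposal): `KillingSpinorEndgame` with clause (i) replaced by
`RecursLateFree` (intrinsic lateness, label free, orthochronous motions); hypothesis (ii) and the
conclusion verbatim. [cite: DafermosLuk2017, Conjecture 1] -/
def KillingSpinorEndgameLateFree : Prop :=
  ∃ k : ℕ, ∀ (X : Type) [TopologicalSpace X] [ChartedSpace E3 X] [IsManifold (𝓡 3) ∞ X]
    [T2Space X] [SecondCountableTopology X] [ConnectedSpace X] (D : InitialDataSet (𝓡 3) X),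
    D ∈ admissibleVacuumData X → ∀ 𝒟 : VacuumCauchyDevelopment D, 𝒟.IsMaximal →
    Summit.FinalStateConjecture.HasCompleteNullInfinity 𝒟.toCauchyDevelopment →
    (∃ (N : ℕ) (M a r₀ : Fin N → ℝ) (mo : Fin N → ↥lorentzGroup × E4),
      (∀ i, Kerr.IsSubextremal (M i) (a i) ∧
        r₀ i ∈ Ioo (Kerr.rMinus (M i) (a i)) (Kerr.rPlus (M i) (a i))) ∧
      RecursLateFree 𝒟 k N M a r₀ mo) →
    (∀ (O : Set 𝒟.carrier) (d : FinalStateDecomposition 𝒟.toSpacetime O 2),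
      (∀ i, Kerr.IsSubextremal (d.mass i) (d.spin i)) →
      O = Summit.FinalStateConjecture.exteriorOf 𝒟.toCauchyDevelopment d.charted →
      Summit.FinalStateConjecture.HasExhaustiveCharts d →
      Summit.FinalStateConjecture.IsFutureOriented d →
      Summit.FinalStateConjecture.RaysStayInClosure 𝒟.toCauchyDevelopment O) →
    ∃ (O : Set 𝒟.carrier) (d : FinalStateDecomposition 𝒟.toSpacetime O 2),
      (∀ i, Kerr.IsSubextremal (d.mass i) (d.spin i)) ∧
      O = Summit.FinalStateConjecture.exteriorOf 𝒟.toCauchyDevelopment d.charted ∧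
      Summit.FinalStateConjecture.RaysStayInClosure 𝒟.toCauchyDevelopment O ∧
      Summit.FinalStateConjecture.HasExhaustiveCharts d ∧
      Summit.FinalStateConjecture.IsFutureOriented d

/-- **Re-lined stub 1 — DYNAMICS (label-free late recurrence ⇒ one convergent global gauge of
regularity 3 to SOME orthochronous sub-extremal horizon-penetrating configuration)**; open problem,
carries the whole difficulty (sub-extremal Kerr asymptotic stability in a horizon-penetrating lab
gauge for all `|a| < M`, `N ≥ 2` decoupling); re-description allowed, no η-family interface (w1).
[cite: DafermosRodnianski2008, Conj. 5.1] [cite: KlainermanSzeftel2023, Thm. 1.1] -/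
def Sig.stub_dynamicsFree : Prop :=
  ∃ k : ℕ,
  ∀ (X : Type) [TopologicalSpace X] [ChartedSpace E3 X] [IsManifold (𝓡 3) ∞ X]
    [T2Space X] [SecondCountableTopology X] [ConnectedSpace X] (D : InitialDataSet (𝓡 3) X),
    D ∈ admissibleVacuumData X → ∀ 𝒟 : VacuumCauchyDevelopment D, 𝒟.IsMaximal →
    Summit.FinalStateConjecture.HasCompleteNullInfinity 𝒟.toCauchyDevelopment →
    ∀ (N : ℕ) (M a r₀ : Fin N → ℝ) (mo : Fin N → ↥lorentzGroup × E4),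
    (∀ i, Kerr.IsSubextremal (M i) (a i) ∧
      r₀ i ∈ Ioo (Kerr.rMinus (M i) (a i)) (Kerr.rPlus (M i) (a i))) →
    RecursLateFree 𝒟 k N M a r₀ mo →
    ∃ (N' : ℕ) (M' a' r₀' : Fin N' → ℝ) (mo' : Fin N' → ↥lorentzGroup × E4),
      (∀ i, Kerr.IsSubextremal (M' i) (a' i) ∧
        r₀' i ∈ Ioo (Kerr.rMinus (M' i) (a' i)) (Kerr.rPlus (M' i) (a' i)) ∧
        Summit.FinalStateConjecture.IsOrthochronous (mo' i).1) ∧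
      GlobalGauge 𝒟 3 N' M' a' r₀' mo'

/-- **Re-lined stub 2 — PACKAGING (a convergent global gauge of regularity 3 to an orthochronous
sub-extremal horizon-penetrating configuration packages into an honest exterior decomposition)**;
XL causal bookkeeping (w2: edge = horizon forced; `C³` horizon graph; orthochronous needed).
[cite: DafermosLuk2017, Conjecture 1 (b)–(c)] -/
def Sig.stub_packagingFree : Prop :=
  ∀ (X : Type) [TopologicalSpace X] [ChartedSpace E3 X] [IsManifold (𝓡 3) ∞ X]
    [T2Space X] [SecondCountableTopology X] [ConnectedSpace X] (D : InitialDataSet (𝓡 3) X),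
    D ∈ admissibleVacuumData X → ∀ 𝒟 : VacuumCauchyDevelopment D, 𝒟.IsMaximal →
    Summit.FinalStateConjecture.HasCompleteNullInfinity 𝒟.toCauchyDevelopment →
    ∀ (N : ℕ) (M a r₀ : Fin N → ℝ) (mo : Fin N → ↥lorentzGroup × E4),
    (∀ i, Kerr.IsSubextremal (M i) (a i) ∧
      r₀ i ∈ Ioo (Kerr.rMinus (M i) (a i)) (Kerr.rPlus (M i) (a i)) ∧
      Summit.FinalStateConjecture.IsOrthochronous (mo i).1) →
    GlobalGauge 𝒟 3 N M a r₀ mo → HonestExterior 𝒟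

/-- **The corrected two-stub skeleton closes the corrected restated crux** (pure logic, as in
`Birth.KillingSpinorEndgame_of`: dynamics ⇒ one convergent gauge to an orthochronous `p′` ⇒ honest
`(O, d)`; the interior-lemma hypothesis (ii) applied to `(O, d)` supplies `RaysStayInClosure O`).
[folklore] -/
theorem killingSpinorEndgameLateFree_of :
    Sig.stub_dynamicsFree → Sig.stub_packagingFree → KillingSpinorEndgameLateFree := by
  intro hdyn hpack
  obtain ⟨k, hk⟩ := hdyn
  refine ⟨k, ?_⟩
  intro X _ _ _ _ _ _ D hD 𝒟 hmax hscri hrec hint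
  obtain ⟨N, M, a, r₀, mo, hsub, hrec⟩ := hrec
  obtain ⟨N', M', a', r₀', mo', hsub', hgg⟩ := hk X D hD 𝒟 hmax hscri N M a r₀ mo hsub hrec
  obtain ⟨O, d, hdsub, hO, hexh, hfo⟩ := hpack X D hD 𝒟 hmax hscri N' M' a' r₀' mo' hsub' hgg
  exact ⟨O, d, hdsub, hO, hint O d hdsub hO hexh hfo, hexh, hfo⟩

end

end Summit.FinalStateConjecture.FinalStateConjecture.Cruxes.KillingSpinorEndgame.ProposedC1
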